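import Summits.QuantumFields.GaugeBoot.Rows.KZL2rpD4Labels
import Summits.QuantumFields.GaugeBoot.WordRectangle
import Summits.QuantumFields.GaugeBoot.WilsonLoopLowerBounds
import HarnessLib

/-!
# Gauge-boot / ym-instrument: the `W̄(1×2)` and `W̄(2×2)` columns of the kz-L2-rp-4D problems (`SU(2)`, `D = 4`)

Cell `ym-instrument` (HUMAN RULING D-0084 (2), director-ym R138; crew (a) Lean typist `ym-instrument-boot-lean-1`), on top of the binding layer of
the inherited cell `pub-gaugeboot` for the certified kz-L2-rp-4D family (`Rows/KZL2rpD4Labels`: the 10878 column labels `label v` of the problem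
files `certs/SU2-D4/kz-L2-rp/beta-<p>-<q>-{upper,lower}.problem1.json`, their torus values `KZL2rpD4.y β L v = ⟨W_0(label v)⟩`, and
`plaquetteExpectation_eq_y_one`).

HONEST FRAMING (page 1 of every file of this cell): this file certifies NOTHING numerically. It identifies two further columns of the SAME
problem files with tree observables, so that a certificate of the instrument question Q-A1 (`pub/ym-instrument/QUESTIONS.md`: `W̄(1×2)`, `W̄(2×2)`
and the χ(2,2) sign functional `W̄(1×2) − (c/2)·W̄(2×2) − (1/(2c))·ū_P` on the kz-L2-rp-4D relaxation) binds to `GaugeBoot.wilsonLoopExpectation`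
WITHOUT any new label machinery. Certified bounds of this cell are bounds on lattice expectations at stated `(G, D, L, β)`; not a mass gap, not a
continuum limit, not a string tension; nothing here is summit-bearing.

## Content (read off the files of record; `decide +kernel` on the packed label table)
* `label_two`: column `2` is `[+e₀,+e₀,+e₁,−e₀,−e₀,−e₁]` = `Word.rectangle 0 1 2 1` (the `2 × 1` rectangle; eng dialect `[1,1,2,-1,-1,-2]`);
* `label_thirteen`: column `13` is `[+e₀,+e₀,+e₁,+e₁,−e₀,−e₀,−e₁,−e₁]` = `Word.rectangle 0 1 2 2` (eng dialect `[1,1,2,2,-1,-1,-2,-2]`);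
* `wilsonLoopExpectation_one_two_eq_y_two`: `⟨W̄(1×2)⟩_{(ℤ/L)⁴, SU(2), β} = y β L 2` (`W̄(1×2) = W̄(2×1)`, `WordRectangle.wilsonLoopExpectation_eq_wordLoop`);
* `wilsonLoopExpectation_two_two_eq_y_thirteen`: `⟨W̄(2×2)⟩ = y β L 13`;
* `chi22Functional_eq_y`: the certifier's (S+) functional in the variables: `W̄(1×2) − (c/2)·W̄(2×2) − (1/(2c))·ū_P = y 2 − (c/2)·y 13 − (1/(2c))·y 1`.
-/

noncomputable section

open Literature.MathematicalPhysics.QuantumFieldTheory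

namespace Summit.QuantumFields.GaugeBoot

namespace KZL2rpD4

/-- Column `2` of the kz-L2-rp-4D problem files is the `2 × 1` rectangle word `+e₀+e₀+e₁−e₀−e₀−e₁`. -/
theorem label_two : label 2 = [.fwd 0, .fwd 0, .fwd 1, .bwd 0, .bwd 0, .bwd 1] := by decide +kernel

/-- Column `13` of the kz-L2-rp-4D problem files is the `2 × 2` rectangle word `+e₀+e₀+e₁+e₁−e₀−e₀−e₁−e₁`. -/
theorem label_thirteen : label 13 = [.fwd 0, .fwd 0, .fwd 1, .fwd 1, .bwd 0, .bwd 0, .bwd 1, .bwd 1] := by decide +kernel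

/-- Column `2` as a rectangle word: `label 2 = Word.rectangle 0 1 2 1`. -/
theorem label_two_eq_rectangle : label 2 = Word.rectangle 0 1 2 1 := by rw [label_two]; rfl

/-- Column `13` as a rectangle word: `label 13 = Word.rectangle 0 1 2 2`. -/
theorem label_thirteen_eq_rectangle : label 13 = Word.rectangle 0 1 2 2 := by rw [label_thirteen]; rfl

variable (β : ℝ) (L : ℕ) [NeZero L]

/-- `⟨W̄(R×T)⟩_{(ℤ/L)⁴, SU(2), β_std}` is the torus value of the rectangle word in the `(0,1)` plane at the origin (`Rung0D4.W`). -/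
theorem wilsonLoopExpectation_eq_W_rectangle (R T : ℕ) :
    wilsonLoopExpectation 2 4 L β R T = Rung0D4.W β L (Word.rectangle 0 1 R T) :=
  wilsonLoopExpectation_eq_wordLoop 2 4 L β R T (0 : Site 4 L) (show (0 : Fin 4) ≠ 1 by decide)

/-- **`⟨W̄(1×2)⟩ = y 2`** (the `1 × 2` Wilson loop is column `2`; `W̄(1×2) = W̄(2×1)` by the axis symmetry of the torus state). -/
theorem wilsonLoopExpectation_one_two_eq_y_two : wilsonLoopExpectation 2 4 L β 1 2 = y β L 2 := by
  rw [wilsonLoopExpectation_comm (N := 2) (by norm_num) L β 1 2, wilsonLoopExpectation_eq_W_rectangle, y,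
    label_two_eq_rectangle]

/-- **`⟨W̄(2×2)⟩ = y 13`** (the `2 × 2` Wilson loop is column `13`). -/
theorem wilsonLoopExpectation_two_two_eq_y_thirteen : wilsonLoopExpectation 2 4 L β 2 2 = y β L 13 := by
  rw [wilsonLoopExpectation_eq_W_rectangle, y, label_thirteen_eq_rectangle]

/-- **The χ(2,2) sign functional in the problem variables**: for every `c`,
`W̄(1×2) − (c/2)·W̄(2×2) − (1/(2c))·ū_P = y 2 − (c/2)·y 13 − (1/(2c))·y 1` on the torus state (`SU(2)`, `D = 4`, any `β_std`, any `L`).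
This is the left-hand side a 'lin:chi22-c<p>o<q>' certificate of the instrument cell bounds from below. -/
theorem chi22Functional_eq_y (c : ℝ) :
    wilsonLoopExpectation 2 4 L β 1 2 - c / 2 * wilsonLoopExpectation 2 4 L β 2 2 -
        1 / (2 * c) * plaquetteExpectation 2 4 L β =
      y β L 2 - c / 2 * y β L 13 - 1 / (2 * c) * y β L 1 := by
  rw [wilsonLoopExpectation_one_two_eq_y_two, wilsonLoopExpectation_two_two_eq_y_thirteen, plaquetteExpectation_eq_y_one]

end KZL2rpD4

end Summit.QuantumFields.GaugeBoot

end
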